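import Mathlib
import HarnessLib

/-!
# Dyadic chaining of cutoff comparisons: steps `M → M′ ≤ 2M` of size `c/√M` sum to `(2+√2)·c/√M` for every `M′ ≥ M`

Topic `MathematicalPhysics/QuantumLattice`; bookkeeping for the Matsubara cutoff direction of the Hubbard programme
(`HubbardMatsubaraCutoffEmbedding` … `HubbardMatsubaraShellGrid`).  The shell covariance between cutoffs `M ≤ M″` has a bounded Fourier–Gram
constant only for SUB-DYADIC shells `M″ ≤ 2M` (`HubbardMatsubaraShellGram`: `κ_S² = 2(M″−M)/(π(2M+1))`), while its decay and tadpole are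
`O(β/√M)`, `O(β/M)`.  Two arbitrary cutoffs `M ≤ M′` are therefore compared along the chain `M → 2M → 4M → ⋯ → 2^J M → M′`: if every
sub-dyadic step costs `≤ c/√M` then, since `Σ_j 2^{-j/2} = 2 + √2`,

  `‖f M′ − f M‖ ≤ (2 + √2)·c/√M`   for all `M₀ ≤ M ≤ M′`, `1 ≤ M`   (**`norm_sub_le_of_subdyadic_steps`**),

uniformly in `M′` — the CAUCHY (in the cutoff) form consumed by the two-volume/two-cutoff doors of the KL programme.  Also the plain geometric
version with a general ratio (`norm_sub_le_of_subdyadic_steps_geometric`).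

Everything is proved; no definitions, no named facts.

## Sources
G. Benfatto, A. Giuliani, V. Mastropietro, Ann. Henri Poincaré 7 (2006) 809–898, §2.1 (2.3)–(2.6) (the limit `M → ∞` of the truncated theory)
[`BenfattoGiulianiMastropietro2006`]; W. de S. Pedra, M. Salmhofer, Commun. Math. Phys. 282 (2008) 797–818, §5 (dyadic frequency shells)
[`PedraSalmhofer2008`].  The `[cite: …]` tags LOCATE the constructs; the statements are elementary.
-/

namespace Literature.MathematicalPhysics.QuantumLattice

open Finset

variable {E : Type*} [SeminormedAddCommGroup E]

/-- **Dyadic chaining**: if every sub-dyadic step `M ≤ M′ ≤ 2M` (from `M ≥ M₀`) costs `‖f M′ − f M‖ ≤ c/√M`, then EVERY pair `M₀ ≤ M ≤ M′`,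
`1 ≤ M`, costs `‖f M′ − f M‖ ≤ (2+√2)·c/√M` (chain `M → 2M → ⋯`; `(2+√2)/√2 + 1 = 2+√2`). [cite: BenfattoGiulianiMastropietro2006, §2.1 (2.3)–(2.6)] -/
theorem norm_sub_le_of_subdyadic_steps (f : ℕ → E) {c : ℝ} (hc : 0 ≤ c) {M₀ : ℕ}
    (hstep : ∀ M M' : ℕ, M₀ ≤ M → M ≤ M' → M' ≤ 2 * M → ‖f M' - f M‖ ≤ c / Real.sqrt M) :
    ∀ M M' : ℕ, M₀ ≤ M → 1 ≤ M → M ≤ M' → ‖f M' - f M‖ ≤ (2 + Real.sqrt 2) * c / Real.sqrt M := by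
  -- strong induction on the gap `M' - M`
  suffices h : ∀ d M M' : ℕ, M' - M ≤ d → M₀ ≤ M → 1 ≤ M → M ≤ M' → ‖f M' - f M‖ ≤ (2 + Real.sqrt 2) * c / Real.sqrt M from
    fun M M' h₀ h1 hle => h (M' - M) M M' le_rfl h₀ h1 hle
  intro d
  induction d using Nat.strong_induction_on with
  | _ d ih =>
    intro M M' hd h₀ h1 hle
    have hMpos : (0 : ℝ) < M := by exact_mod_cast h1
    have hsq : 0 < Real.sqrt M := Real.sqrt_pos.2 hMpos
    have h22 : (1 : ℝ) ≤ 2 + Real.sqrt 2 := by have := Real.sqrt_nonneg 2; linarith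
    by_cases h2 : M' ≤ 2 * M
    · -- one step
      refine (hstep M M' h₀ hle h2).trans ?_
      rw [mul_div_assoc]
      exact le_mul_of_one_le_left (by positivity) h22
    · -- go through `2M`
      push Not at h2
      have hstep1 := hstep M (2 * M) h₀ (by omega) le_rfl
      have hd' : M' - 2 * M < d := by omega
      have ih' := ih (M' - 2 * M) hd' (2 * M) M' le_rfl (by omega) (by omega) h2.le
      have hsqrt2 : Real.sqrt ((2 * M : ℕ) : ℝ) = Real.sqrt 2 * Real.sqrt M := by
        push_cast; exact Real.sqrt_mul (by norm_num) _
      calc ‖f M' - f M‖ ≤ ‖f M' - f (2 * M)‖ + ‖f (2 * M) - f M‖ := norm_sub_le_norm_sub_add_norm_sub _ _ _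
        _ ≤ (2 + Real.sqrt 2) * c / Real.sqrt ((2 * M : ℕ) : ℝ) + c / Real.sqrt M := add_le_add ih' hstep1
        _ = (2 + Real.sqrt 2) * c / Real.sqrt M := by
            rw [hsqrt2]
            have hs2 : Real.sqrt 2 ≠ 0 := by positivity
            have hs22 : Real.sqrt 2 * Real.sqrt 2 = 2 := Real.mul_self_sqrt (by norm_num)
            field_simp
            nlinarith [hs22]

/-- **Dyadic chaining, geometric form**: if the sub-dyadic steps from `M` cost `≤ g M` with `g (2M) ≤ r·g M`, `0 ≤ r < 1`, `g ≥ 0`, then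
`‖f M′ − f M‖ ≤ g M/(1 − r)` for all `M₀ ≤ M ≤ M′`, `1 ≤ M`. [cite: BenfattoGiulianiMastropietro2006, §2.1 (2.3)–(2.6)] -/
theorem norm_sub_le_of_subdyadic_steps_geometric (f : ℕ → E) (g : ℕ → ℝ) (hg : ∀ M, 0 ≤ g M) {r : ℝ} (hr0 : 0 ≤ r) (hr1 : r < 1)
    (hgr : ∀ M : ℕ, 1 ≤ M → g (2 * M) ≤ r * g M) {M₀ : ℕ}
    (hstep : ∀ M M' : ℕ, M₀ ≤ M → M ≤ M' → M' ≤ 2 * M → ‖f M' - f M‖ ≤ g M) :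
    ∀ M M' : ℕ, M₀ ≤ M → 1 ≤ M → M ≤ M' → ‖f M' - f M‖ ≤ g M / (1 - r) := by
  suffices h : ∀ d M M' : ℕ, M' - M ≤ d → M₀ ≤ M → 1 ≤ M → M ≤ M' → ‖f M' - f M‖ ≤ g M / (1 - r) from
    fun M M' h₀ h1 hle => h (M' - M) M M' le_rfl h₀ h1 hle
  intro d
  induction d using Nat.strong_induction_on with
  | _ d ih =>
    intro M M' hd h₀ h1 hle
    have h1r : 0 < 1 - r := by linarith
    by_cases h2 : M' ≤ 2 * M
    · refine (hstep M M' h₀ hle h2).trans ?_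
      rw [le_div_iff₀ h1r]
      nlinarith [hg M]
    · push Not at h2
      have hstep1 := hstep M (2 * M) h₀ (by omega) le_rfl
      have hd' : M' - 2 * M < d := by omega
      have ih' := ih (M' - 2 * M) hd' (2 * M) M' le_rfl (by omega) (by omega) h2.le
      calc ‖f M' - f M‖ ≤ ‖f M' - f (2 * M)‖ + ‖f (2 * M) - f M‖ := norm_sub_le_norm_sub_add_norm_sub _ _ _
        _ ≤ g (2 * M) / (1 - r) + g M := add_le_add ih' hstep1
        _ ≤ r * g M / (1 - r) + g M := by gcongr; exact hgr M h1
        _ = g M / (1 - r) := by field_simp; ring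

end Literature.MathematicalPhysics.QuantumLattice
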